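import Literature.Algebra.Lie.LefschetzModuleAdjoint
import Mathlib.LinearAlgebra.Dual.Lemmas
import HarnessLib

/-!
# Lefschetz modules are closed under taking duals: `𝔤(-𝔞ᵀ, M^*) = -𝔤(𝔞, M)ᵀ` (Looijenga–Lunts 1997, §1)

Topic `Literature/Algebra/Lie` (namespace `Literature.Algebra.Lie`).  Lane `lit-hodgefound` (Track 2 foundations
library), skeleton seat `lit-hodgefound-skel-1` (generation 41), row **A1-105** of
`run/shared/lean/pub/lit-hodgefound/SKELETON.md`: the DUALS clause of "closed under direct sums, tensor products and
taking duals" at the level of A1-88's `IsLefschetzModule` (A1-94 = `LefschetzModule.lean` §12 has the Lefschetz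
PROPERTY of `-eᵀ` on `(M^*, -hᵀ)`; A1-99 / A1-104 the direct-sum / tensor clauses), via `LefschetzModuleAdjoint.lean` §1
(A1-101: "if `h` and `e` happen to be contained in a semisimple Lie subalgebra … then so is `f`").  PROVED theorems and ONE
definition with body (`negDualMap` = the contragredient morphism `x ↦ -xᵀ`); no named fact, no `sorry`, no instance
(D-0026 net debt `0`).  `LieRing.ofAssociativeRing` is enabled FILE-LOCALLY as in the rest of the series.

## Source, VERBATIM

E. Looijenga, V. A. Lunts, *A Lie algebra attached to a projective variety*, Invent. Math. **129** (1997) 361–412 (held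
text `paper:arxiv-alg-geom_9604014`, p0004):

> (L62–L63) "The collection of Lefschetz modules is closed under direct sums, tensor products and taking duals."
> (L25–L26) "If `h` and `e` happen to be contained in a semisimple Lie subalgebra `𝔤 ⊂ 𝔤𝔩(M)`, then so is `f`."

No proof is printed.

## Rendering (dictionary, continuing A1-88 / A1-94)

* `M^* = Module.Dual K M` with the contragredient operators `-xᵀ = -x.dualMap` (A1-94); **`negDualMap K M`** is the
  morphism of Lie algebras `𝔤𝔩(M) → 𝔤𝔩(M^*)`, `x ↦ -xᵀ` (A1-94's `lie_neg_dualMap`); "`𝔞` acting on the dual" =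
  the subspace `𝔞.map negDualMap = -𝔞ᵀ ≤ 𝔤𝔩(M^*)`, graded by `-hᵀ = negDualMap h`.

## Contents (all proved)

* §1 `negDualMap` (def), `negDualMap_apply`, `negDualMap_injective`, `negDualMap_ne_zero`,
  `isSl2Triple_negDualMap_iff` (`(-eᵀ, -hᵀ, -fᵀ)` is an `𝔰𝔩₂`-triple iff `(e, h, f)` is).
* §2 **`lefschetzDuals_map_negDualMap`** (the image of `f` for `(-𝔞ᵀ, M^*)` is `-(image of f)ᵀ`: every partner of a
  `-e_aᵀ` lies in the semisimple `-𝔤(𝔞, M)ᵀ` — A1-101's `mem_of_isSl2Triple` — and pulls back along the injective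
  `x ↦ -xᵀ`), **`lefschetzLieAlgebra_map_negDualMap`** (`𝔤(-𝔞ᵀ, M^*) = -𝔤(𝔞, M)ᵀ`, A1-101's `map_lieSpan`),
  `IsLefschetzModule.isSemisimple_lefschetzLieAlgebra_dual`, **`IsLefschetzModule.dual`** (the dual of a Lefschetz module
  is a Lefschetz module: `ℤ`-graded by A1-94 `isZGrading_neg_dualMap`, `-𝔞ᵀ ⊆ 𝔤𝔩(M^*)₂` abelian, Lefschetz element
  `-e_aᵀ` with partner `-f_aᵀ`, `𝔤(-𝔞ᵀ, M^*) ≅ 𝔤(𝔞, M)` semisimple).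

## SCOPE (what is NOT formalised here)

(a) The identification `M^{**} = M` / involutivity of the construction and the compatibility with the invariant forms
of (1.3) are not formalised.  (b) Nothing here concerns complex tori or the Hodge conjecture.

## References

* [LooijengaLunts1997] E. Looijenga, V. A. Lunts, *A Lie algebra attached to a projective variety*, Invent. Math. 129
  (1997) 361–412; arXiv:alg-geom/9604014. §1 p. 4 L25–L26, L62–L63 (held `paper:arxiv-alg-geom_9604014` p0004).
-/

noncomputable section

namespace Literature.Algebra.Lie

open Module Function Set LieModule

-- The commutator Lie ring of `𝔤𝔩(·) = Module.End K ·`: Mathlib's reducible NON-instance `LieRing.ofAssociativeRing`,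
-- enabled file-locally exactly as in `LefschetzModule.lean`.
attribute [local instance 100] LieRing.ofAssociativeRing

/-! ### §1 The contragredient morphism `x ↦ -xᵀ` -/

section Defs

variable (K : Type*) [CommRing K] (M : Type*) [AddCommGroup M] [Module K M]

/-- **The contragredient morphism `𝔤𝔩(M) → 𝔤𝔩(M^*)`, `x ↦ -xᵀ`** ("taking duals": `𝔞` acts on `M^* = Module.Dual K M`
through `-e_aᵀ`), a morphism of Lie algebras by A1-94's `lie_neg_dualMap` (`[-aᵀ, -bᵀ] = -[a, b]ᵀ`).
[cite: LooijengaLunts1997, §1 (1.1) p0004 L62–L63 ("closed under … taking duals")] -/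
def negDualMap : Module.End K M →ₗ⁅K⁆ Module.End K (Module.Dual K M) where
  toFun x := -x.dualMap
  map_add' x y := by
    refine LinearMap.ext fun φ ↦ LinearMap.ext fun m ↦ ?_
    simp only [LinearMap.neg_apply, LinearMap.add_apply, LinearMap.dualMap_apply, map_add, neg_add]
  map_smul' c x := by
    refine LinearMap.ext fun φ ↦ LinearMap.ext fun m ↦ ?_
    simp only [LinearMap.neg_apply, LinearMap.smul_apply, LinearMap.dualMap_apply, map_smul, RingHom.id_apply,
      smul_neg]
  map_lie' {x y} := (lie_neg_dualMap x y).symm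

variable {K M}

/-- `negDualMap x = -xᵀ`. [cite: LooijengaLunts1997, §1 (1.1) p0004 L62–L63] -/
@[simp] theorem negDualMap_apply (x : Module.End K M) : negDualMap K M x = -x.dualMap := rfl

end Defs

section Field

variable {K : Type*} [Field K] {M : Type*} [AddCommGroup M] [Module K M]

/-- `x ↦ -xᵀ` is injective (a functional-separating argument: `φ(x m) = 0` for all `φ` forces `x m = 0`).
[cite: LooijengaLunts1997, §1 (1.1) p0004 L62–L63] -/
theorem negDualMap_injective : Function.Injective (negDualMap K M) := by
  intro x y hxy
  rw [negDualMap_apply, negDualMap_apply] at hxy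
  refine LinearMap.ext fun m ↦ ?_
  rw [← sub_eq_zero, ← LinearMap.sub_apply, ← (Module.forall_dual_apply_eq_zero_iff K ((x - y) m))]
  intro φ
  have h1 := LinearMap.congr_fun (LinearMap.congr_fun hxy φ) m
  simp only [LinearMap.neg_apply, LinearMap.dualMap_apply, neg_inj] at h1
  rw [LinearMap.sub_apply, map_sub, h1, sub_self]

/-- `-hᵀ ≠ 0` for `h ≠ 0`. [cite: LooijengaLunts1997, §1 (1.1) p0004 L62–L63] -/
theorem negDualMap_ne_zero {h : Module.End K M} (h0 : h ≠ 0) : negDualMap K M h ≠ 0 := fun h1 ↦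
  h0 (negDualMap_injective (by rw [h1, map_zero]))

/-- `𝔰𝔩₂`-triples go to `𝔰𝔩₂`-triples: `(-eᵀ, -hᵀ, -fᵀ)` (A1-94's relations, or: an injective morphism).
[cite: LooijengaLunts1997, §1 (1.1) p0004 L62–L63] -/
theorem isSl2Triple_negDualMap_iff {h e f : Module.End K M} :
    IsSl2Triple (negDualMap K M h) (negDualMap K M e) (negDualMap K M f) ↔ IsSl2Triple h e f :=
  isSl2Triple_map_iff_of_injective (negDualMap K M) negDualMap_injective

end Field

/-! ### §2 `𝔤(-𝔞ᵀ, M^*) = -𝔤(𝔞, M)ᵀ` and `IsLefschetzModule.dual` -/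

section Main

variable {K : Type*} [Field K] [CharZero K] {M : Type*} [AddCommGroup M] [Module K M] [FiniteDimensional K M]
  {h : Module.End K M} {𝔞 : Submodule K (Module.End K M)}

/-- **The image of `f` for `(-𝔞ᵀ, M^*)` is `-(image of f)ᵀ`** when `𝔤(𝔞, M)` is semisimple (and contains `h`): a
partner `F ∈ 𝔤𝔩(M^*)` of `-e_aᵀ` lies in the semisimple subalgebra `-𝔤(𝔞, M)ᵀ ∋ -hᵀ, -e_aᵀ` ("if `h` and `e` happen
to be contained in a semisimple Lie subalgebra … then so is `f`", A1-101), so `F = -fᵀ` with `(e_a, h, f)` an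
`𝔰𝔩₂`-triple of `𝔤𝔩(M)` (injectivity of `x ↦ -xᵀ`). [cite: LooijengaLunts1997, §1 (1.1) p0004 L25–L26, L62–L63] -/
theorem lefschetzDuals_map_negDualMap (hh : h ∈ lefschetzLieAlgebra K h 𝔞)
    [LieAlgebra.IsSemisimple K (lefschetzLieAlgebra K h 𝔞)] :
    lefschetzDuals K (negDualMap K M h) (𝔞.map (negDualMap K M : Module.End K M →ₗ[K] Module.End K (Module.Dual K M))) =
      negDualMap K M '' lefschetzDuals K h 𝔞 := by
  -- the semisimple image
  haveI : FiniteDimensional K (lefschetzLieAlgebra K h 𝔞) :=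
    inferInstanceAs (FiniteDimensional K (lefschetzLieAlgebra K h 𝔞).toSubmodule)
  haveI : FiniteDimensional K ((lefschetzLieAlgebra K h 𝔞).map (negDualMap K M)) :=
    inferInstanceAs (FiniteDimensional K ((lefschetzLieAlgebra K h 𝔞).map (negDualMap K M)).toSubmodule)
  haveI : LieAlgebra.IsSemisimple K ((lefschetzLieAlgebra K h 𝔞).map (negDualMap K M)) := by
    have hsurj : Function.Surjective (((negDualMap K M).comp (lefschetzLieAlgebra K h 𝔞).incl).rangeRestrict) :=
      LieHom.surjective_rangeRestrict _
    have heq : ((negDualMap K M).comp (lefschetzLieAlgebra K h 𝔞).incl).range =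
        (lefschetzLieAlgebra K h 𝔞).map (negDualMap K M) := by
      ext F
      rw [LieHom.mem_range, LieSubalgebra.mem_map]
      constructor
      · rintro ⟨x, rfl⟩; exact ⟨x, x.2, rfl⟩
      · rintro ⟨x, hx, rfl⟩; exact ⟨⟨x, hx⟩, rfl⟩
    rw [← heq]
    exact isSemisimple_of_surjective _ hsurj
  ext F
  constructor
  · rintro ⟨E, hE, t⟩
    obtain ⟨a, ha, rfl⟩ := Submodule.mem_map.1 hE
    have hF : F ∈ (lefschetzLieAlgebra K h 𝔞).map (negDualMap K M) :=
      mem_of_isSl2Triple _ ((LieSubalgebra.mem_map _ _ _).2 ⟨h, hh, rfl⟩)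
        ((LieSubalgebra.mem_map _ _ _).2 ⟨a, le_lefschetzLieAlgebra ha, rfl⟩) t
    obtain ⟨f, -, rfl⟩ := (LieSubalgebra.mem_map _ _ _).1 hF
    exact ⟨f, ⟨a, ha, isSl2Triple_negDualMap_iff.1 t⟩, rfl⟩
  · rintro ⟨f, ⟨a, ha, t⟩, rfl⟩
    exact ⟨negDualMap K M a, Submodule.mem_map_of_mem ha, isSl2Triple_negDualMap_iff.2 t⟩

/-- **`𝔤(-𝔞ᵀ, M^*) = -𝔤(𝔞, M)ᵀ`** (`𝔤(𝔞, M)` semisimple): the generators correspond under the morphism `x ↦ -xᵀ`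
(`map_lieSpan`, A1-101). [cite: LooijengaLunts1997, §1 (1.1) p0004 L62–L63, L86–L88] -/
theorem lefschetzLieAlgebra_map_negDualMap (hh : h ∈ lefschetzLieAlgebra K h 𝔞)
    [LieAlgebra.IsSemisimple K (lefschetzLieAlgebra K h 𝔞)] :
    lefschetzLieAlgebra K (negDualMap K M h) (𝔞.map (negDualMap K M : Module.End K M →ₗ[K] Module.End K (Module.Dual K M))) =
      (lefschetzLieAlgebra K h 𝔞).map (negDualMap K M) := by
  rw [lefschetzLieAlgebra, lefschetzLieAlgebra, map_lieSpan, Set.image_union, lefschetzDuals_map_negDualMap hh,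
    Submodule.map_coe]
  rfl

/-- **`𝔤(-𝔞ᵀ, M^*)` is semisimple** for a Lefschetz module `(𝔞, M)` (isomorphic image of `𝔤(𝔞, M)`).
[cite: LooijengaLunts1997, §1 (1.1) p0004 L62–L63] -/
theorem IsLefschetzModule.isSemisimple_lefschetzLieAlgebra_dual (A : IsLefschetzModule K h 𝔞) :
    LieAlgebra.IsSemisimple K (lefschetzLieAlgebra K (negDualMap K M h)
      (𝔞.map (negDualMap K M : Module.End K M →ₗ[K] Module.End K (Module.Dual K M)))) := by
  haveI := A.isSemisimple
  haveI : FiniteDimensional K (lefschetzLieAlgebra K h 𝔞) :=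
    inferInstanceAs (FiniteDimensional K (lefschetzLieAlgebra K h 𝔞).toSubmodule)
  rw [lefschetzLieAlgebra_map_negDualMap A.h_mem]
  have heq : ((negDualMap K M).comp (lefschetzLieAlgebra K h 𝔞).incl).range =
      (lefschetzLieAlgebra K h 𝔞).map (negDualMap K M) := by
    ext F
    rw [LieHom.mem_range, LieSubalgebra.mem_map]
    constructor
    · rintro ⟨x, rfl⟩; exact ⟨x, x.2, rfl⟩
    · rintro ⟨x, hx, rfl⟩; exact ⟨⟨x, hx⟩, rfl⟩
  haveI : FiniteDimensional K ((negDualMap K M).comp (lefschetzLieAlgebra K h 𝔞).incl).range :=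
    inferInstanceAs (FiniteDimensional K ((negDualMap K M).comp (lefschetzLieAlgebra K h 𝔞).incl).range.toSubmodule)
  rw [← heq]
  exact isSemisimple_of_surjective _ (LieHom.surjective_rangeRestrict _)

/-- **"The collection of Lefschetz modules is closed under … taking duals": `(-𝔞ᵀ, M^*)` is a Lefschetz module
(A1-88's `IsLefschetzModule`) when `(𝔞, M)` is** — `(M^*, -hᵀ)` is `ℤ`-graded (A1-94 `isZGrading_neg_dualMap`),
`-𝔞ᵀ ⊆ 𝔤𝔩(M^*)₂` is abelian, `-e_aᵀ` has the partner `-f_aᵀ`, and `𝔤(-𝔞ᵀ, M^*) = -𝔤(𝔞, M)ᵀ ≅ 𝔤(𝔞, M)` is semisimple.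
[cite: LooijengaLunts1997, §1 (1.1) p0004 L62–L63] -/
theorem IsLefschetzModule.dual (A : IsLefschetzModule K h 𝔞) :
    IsLefschetzModule K (negDualMap K M h)
      (𝔞.map (negDualMap K M : Module.End K M →ₗ[K] Module.End K (Module.Dual K M))) where
  isZGrading := isZGrading_neg_dualMap A.isZGrading
  le_adDegree_two := by
    rintro _ ⟨a, ha, rfl⟩
    rw [mem_adDegree_iff]
    show ⁅negDualMap K M h, negDualMap K M a⁆ = (2 : K) • negDualMap K M a
    rw [← LieHom.map_lie, mem_adDegree_iff.1 (A.le_adDegree_two ha), map_smul]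
  lie_eq_zero := by
    rintro _ ⟨a, ha, rfl⟩ _ ⟨b, hb, rfl⟩
    show ⁅negDualMap K M a, negDualMap K M b⁆ = 0
    rw [← LieHom.map_lie, A.lie_eq_zero a ha b hb, map_zero]
  nonempty_lefschetzDomain := by
    obtain ⟨e, he, f, t⟩ := A.nonempty_lefschetzDomain
    exact ⟨negDualMap K M e, Submodule.mem_map_of_mem he, negDualMap K M f, isSl2Triple_negDualMap_iff.2 t⟩
  isSemisimple := A.isSemisimple_lefschetzLieAlgebra_dual

end Main

end Literature.Algebra.Lie
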